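import Summits.AtomisticToContinuum.FouriersLaw.Theorems.UnboundedHeatVariance.Negative.AbstractCage
import HarnessLib

/-!
# Stub `stub_fibrewiseRelaxationInsufficient` of line `Sketch` — the spectral TIGHTNESS witness FR
(crux `CageBudgetFekete.UnboundedHeatVariance`, item stmt-AtomisticToContinuum-15771; `--supports` file)

WHAT. The registered satellite FR of the skeleton `Cruxes/UnboundedHeatVariance/Lines/Sketch.lean`, in the
spectral dictionary of the line: `σ k` = spectral measure of the energy-density fibre `h(k)` (mass `χ`,
`σ 0 = χ δ₀` = conservation), `ρ_k := ω² σ_k / (2 - 2cos k)` = spectral measure of the current fibre (continuity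
equation), `ρ₀` = representing measure of the summed current autocorrelation `C`. U holds iff `ρ₀` charges the
infrared (`0 < ρ₀{0} ∨ ω⁻² ∉ L¹(ρ₀)`). The theorem: even if NO energy fibre with `cos k ≠ 1` has a conserved
component (`σ k {0} = 0`, fibrewise ergodicity / relaxation), the fibres are even, weakly continuous at `k = 0`,
and `ρ_k → ρ₀` weakly as `k → 0`, the limit `ρ₀` need NOT charge the infrared: its heat variance
`2∫_{(0,τ]} (τ-s)(∫cos(ωs)dρ₀) ds` stays `≤ 4`. Abstract measure theory only.

HOW. `χ = 4`, `η k = 1 - cos k`, `σ k = (1 - cos k)(δ₁ + δ₋₁) + (1 + cos k)(δ_{η k} + δ_{-η k})`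
(note `1 + cos k = 2 - η k`), `ρ₀ = ½(δ₁ + δ₋₁)`: four atoms of total mass `4` collapsing to `4δ₀` at `k = 0`,
none of them at `0` when `cos k ≠ 1`; `∫ g dσ_k = (1 - cos k)(g 1 + g(-1)) + (1 + cos k)(g(η k) + g(-η k))`
is continuous in `k`, and `∫ g ω²/(2 - 2cos k) dσ_k = ½(g 1 + g(-1)) + ½(1 + cos k) η_k (g(η k) + g(-η k))
→ ½(g 1 + g(-1)) = ∫ g dρ₀`. The kernel of `ρ₀` is `cos`, caged by the landed closed form
`Negative.integral_Ioc_sub_mul_cos` (`V(τ) = 2(1 - cos τ) ≤ 4`), while `ρ₀{0} = 0` and `ω⁻²` is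
`ρ₀`-integrable. Everything is a finite sum of Dirac integrals.

No definitions; short helper lemmas on symmetric Dirac pairs first, then the stub.
prover-line-stmt-AtomisticToContinuum-15771-c2-0, 2026-08-17.
-/

noncomputable section

namespace Summit.AtomisticToContinuum.FouriersLaw.Theorems.UnboundedHeatVariance.Sketch

open MeasureTheory Set Filter Topology
open scoped ENNReal

/-! ### 1. Symmetric Dirac pairs `δ_x + δ_{-x}` on `ℝ` -/

/-- Every real function is integrable against the symmetric Dirac pair `δ_x + δ_{-x}`. [folklore] -/
theorem integrable_symmPair (g : ℝ → ℝ) (x : ℝ) :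
    Integrable g (Measure.dirac x + Measure.dirac (-x)) :=
  (integrable_dirac enorm_lt_top).add_measure (integrable_dirac enorm_lt_top)

/-- `∫ g d(δ_x + δ_{-x}) = g x + g(-x)`. [folklore] -/
theorem integral_symmPair (g : ℝ → ℝ) (x : ℝ) :
    ∫ w, g w ∂(Measure.dirac x + Measure.dirac (-x)) = g x + g (-x) := by
  rw [integral_add_measure (integrable_dirac enorm_lt_top) (integrable_dirac enorm_lt_top),
    integral_dirac, integral_dirac]

/-- The symmetric Dirac pair `δ_x + δ_{-x}` has total mass `2`. [folklore] -/
theorem symmPair_univ (x : ℝ) : (Measure.dirac x + Measure.dirac (-x)) univ = 2 := by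
  rw [Measure.add_apply, measure_univ, measure_univ, one_add_one_eq_two]

/-- The symmetric Dirac pair `δ_x + δ_{-x}` does not charge `0` when `x ≠ 0`. [folklore] -/
theorem symmPair_singleton_zero {x : ℝ} (hx : x ≠ 0) :
    (Measure.dirac x + Measure.dirac (-x)) {0} = 0 := by
  rw [Measure.add_apply, Measure.dirac_apply, Measure.dirac_apply,
    indicator_of_notMem (by simpa using hx), indicator_of_notMem (by simpa using hx), add_zero]

/-- The symmetric Dirac pair `δ_x + δ_{-x}` is even (invariant under `ω ↦ -ω`). [folklore] -/
theorem symmPair_map_neg (x : ℝ) :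
    (Measure.dirac x + Measure.dirac (-x)).map (fun w : ℝ => -w)
      = Measure.dirac x + Measure.dirac (-x) := by
  simp only [Measure.map_add _ _ measurable_neg, Measure.map_dirac, neg_neg]
  exact add_comm _ _

/-! ### 2. The four-atom measures `a(δ₁ + δ₋₁) + b(δ_y + δ_{-y})` -/

/-- `∫ g d(a(δ₁ + δ₋₁) + b(δ_y + δ_{-y})) = a(g 1 + g(-1)) + b(g y + g(-y))` for `a, b ≥ 0` and every real
`g`. [folklore] -/
theorem integral_fourAtom {a b : ℝ} (ha : 0 ≤ a) (hb : 0 ≤ b) (y : ℝ) (g : ℝ → ℝ) :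
    ∫ w, g w ∂(ENNReal.ofReal a • (Measure.dirac 1 + Measure.dirac (-1)) +
        ENNReal.ofReal b • (Measure.dirac y + Measure.dirac (-y)))
      = a * (g 1 + g (-1)) + b * (g y + g (-y)) := by
  rw [integral_add_measure ((integrable_symmPair g 1).smul_measure ENNReal.ofReal_ne_top)
      ((integrable_symmPair g y).smul_measure ENNReal.ofReal_ne_top),
    integral_smul_measure, integral_smul_measure, integral_symmPair, integral_symmPair,
    ENNReal.toReal_ofReal ha, ENNReal.toReal_ofReal hb, smul_eq_mul, smul_eq_mul]

/-- The four-atom measure `a(δ₁ + δ₋₁) + b(δ_y + δ_{-y})` (`a, b ≥ 0`) has total mass `2a + 2b`. [folklore] -/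
theorem fourAtom_univ {a b : ℝ} (ha : 0 ≤ a) (hb : 0 ≤ b) (y : ℝ) :
    (ENNReal.ofReal a • (Measure.dirac 1 + Measure.dirac (-1)) +
        ENNReal.ofReal b • (Measure.dirac y + Measure.dirac (-y)) : Measure ℝ) univ
      = ENNReal.ofReal (2 * a + 2 * b) := by
  rw [Measure.add_apply, Measure.smul_apply, Measure.smul_apply, symmPair_univ, symmPair_univ, smul_eq_mul,
    smul_eq_mul, ENNReal.ofReal_add (by positivity) (by positivity), ENNReal.ofReal_mul zero_le_two,
    ENNReal.ofReal_mul zero_le_two, ENNReal.ofReal_ofNat]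
  ring

/-- The four-atom measure `a(δ₁ + δ₋₁) + b(δ_y + δ_{-y})` does not charge `0` when `y ≠ 0`. [folklore] -/
theorem fourAtom_singleton_zero (a b : ℝ) {y : ℝ} (hy : y ≠ 0) :
    (ENNReal.ofReal a • (Measure.dirac 1 + Measure.dirac (-1)) +
        ENNReal.ofReal b • (Measure.dirac y + Measure.dirac (-y)) : Measure ℝ) {0} = 0 := by
  rw [Measure.add_apply, Measure.smul_apply, Measure.smul_apply, symmPair_singleton_zero one_ne_zero,
    symmPair_singleton_zero hy, smul_zero, smul_zero, add_zero]

/-- The four-atom measure `a(δ₁ + δ₋₁) + b(δ_y + δ_{-y})` is even. [folklore] -/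
theorem fourAtom_map_neg (a b y : ℝ) :
    (ENNReal.ofReal a • (Measure.dirac 1 + Measure.dirac (-1)) +
        ENNReal.ofReal b • (Measure.dirac y + Measure.dirac (-y))).map (fun w : ℝ => -w)
      = ENNReal.ofReal a • (Measure.dirac 1 + Measure.dirac (-1)) +
        ENNReal.ofReal b • (Measure.dirac y + Measure.dirac (-y)) := by
  rw [Measure.map_add _ _ measurable_neg, Measure.map_smul, Measure.map_smul, symmPair_map_neg,
    symmPair_map_neg]

/-- At `a = 0`, `y = 0` the four-atom measure collapses to `2b δ₀`. [folklore] -/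
theorem fourAtom_zero_zero (b : ℝ) :
    ENNReal.ofReal 0 • (Measure.dirac (1:ℝ) + Measure.dirac (-1)) +
        ENNReal.ofReal b • (Measure.dirac 0 + Measure.dirac (-0))
      = ENNReal.ofReal (2 * b) • Measure.dirac (0:ℝ) := by
  rw [ENNReal.ofReal_zero, zero_smul, zero_add, neg_zero, ← two_smul ℝ≥0∞ (Measure.dirac (0:ℝ)), smul_smul,
    ENNReal.ofReal_mul zero_le_two, ENNReal.ofReal_ofNat, mul_comm]

/-! ### 3. The witness -/

/-- **FR — `stub_fibrewiseRelaxationInsufficient` (registered TIGHTNESS satellite of line `Sketch`).** There are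
`χ > 0`, a fibre family `σ : ℝ → Measure ℝ` and a limit measure `ρ₀` such that: every `σ k` is finite of mass
`χ`; `σ 0 = χ δ₀` (conservation); NO fibre with `cos k ≠ 1` charges `0` (fibrewise relaxation); every fibre is
even; `k ↦ ∫ g dσ_k` is continuous at `0` for bounded continuous `g`; `ρ₀` is finite with positive mass and is
the weak limit of the current fibres `ω² σ_k /(2 - 2cos k)` as `k → 0` within `{cos k ≠ 1}`; and yet `ρ₀` does
NOT charge the infrared: `ρ₀{0} = 0`, `ω⁻² ∈ L¹(ρ₀)`, and its heat variance `2∫_{(0,τ]}(τ-s)(∫cos(ωs)dρ₀)ds`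
is `≤ 4` for all `τ ≥ 0`. Witness: `χ = 4`,
`σ k = (1 - cos k)(δ₁ + δ₋₁) + (1 + cos k)(δ_{1-cos k} + δ_{-(1-cos k)})`, `ρ₀ = ½(δ₁ + δ₋₁)` (kernel `cos`,
caged by `Negative.integral_Ioc_sub_mul_cos`). So fibrewise ergodicity of the energy fibres plus weak
convergence of the current fibres cannot replace the infrared input of the line. [folklore] -/
theorem stub_fibrewiseRelaxationInsufficient :
    ∃ (χ : ℝ) (σ : ℝ → MeasureTheory.Measure ℝ) (ρ₀ : MeasureTheory.Measure ℝ), 0 < χ ∧ (∀ k : ℝ, MeasureTheory.IsFiniteMeasure (σ k)) ∧ (∀ k : ℝ, σ k Set.univ = ENNReal.ofReal χ) ∧ σ 0 = ENNReal.ofReal χ • MeasureTheory.Measure.dirac (0:ℝ) ∧ (∀ k : ℝ, Real.cos k ≠ 1 → σ k {0} = 0) ∧ (∀ k : ℝ, (σ k).map (fun w : ℝ => -w) = σ k) ∧ (∀ g : ℝ → ℝ, Continuous g → (∃ B : ℝ, ∀ w : ℝ, |g w| ≤ B) → Filter.Tendsto (fun k : ℝ => ∫ w, g w ∂(σ k))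 (nhds 0) (nhds (∫ w, g w ∂(σ 0)))) ∧ MeasureTheory.IsFiniteMeasure ρ₀ ∧ 0 < ρ₀ Set.univ ∧ (∀ g : ℝ → ℝ, Continuous g → (∃ B : ℝ, ∀ w : ℝ, |g w| ≤ B) → Filter.Tendsto (fun k : ℝ => ∫ w, g w * (w ^ 2 / (2 - 2 * Real.cos k)) ∂(σ k)) (nhdsWithin (0:ℝ) {k : ℝ | Real.cos k ≠ 1}) (nhds (∫ w, g w ∂ρ₀))) ∧ ρ₀ {0} = 0 ∧ MeasureTheory.Integrable (fun w : ℝ => (w ^ 2)⁻¹) ρ₀ ∧ (∀ τ : ℝ, 0 ≤ τ → 2 * ∫ s in Set.Ioc (0:ℝ) τ, (τ - s) * (∫ w, Real.cos (w * s) ∂ρ₀) ≤ 4) ∧ ¬ (0 < ρ₀ {0} ∨ ¬ MeasureTheory.Integrable (fun w : ℝ => (w ^ 2)⁻¹) ρ₀) := by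
  have hc1 : ∀ k : ℝ, 0 ≤ 1 - Real.cos k := fun k => sub_nonneg.2 (Real.cos_le_one k)
  have hc2 : ∀ k : ℝ, 0 ≤ 1 + Real.cos k := fun k => by linarith [Real.neg_one_le_cos k]
  set σ : ℝ → Measure ℝ := fun k =>
    ENNReal.ofReal (1 - Real.cos k) • (Measure.dirac 1 + Measure.dirac (-1)) +
      ENNReal.ofReal (1 + Real.cos k) • (Measure.dirac (1 - Real.cos k) + Measure.dirac (-(1 - Real.cos k)))
    with hσdef
  set ρ₀ : Measure ℝ := ENNReal.ofReal (1 / 2) • (Measure.dirac (1:ℝ) + Measure.dirac (-1)) with hρdef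
  -- fibres: integrals and masses; limit measure: integrals, mass, no atom at `0`, `ω⁻²` integrable
  have hσint : ∀ (k : ℝ) (g : ℝ → ℝ), ∫ w, g w ∂(σ k)
      = (1 - Real.cos k) * (g 1 + g (-1)) + (1 + Real.cos k) * (g (1 - Real.cos k) + g (-(1 - Real.cos k))) :=
    fun k g => integral_fourAtom (hc1 k) (hc2 k) _ g
  have hσuniv : ∀ k : ℝ, σ k univ = ENNReal.ofReal 4 := fun k =>
    (fourAtom_univ (hc1 k) (hc2 k) (1 - Real.cos k)).trans (by congr 1; ring)
  have hρint : ∀ g : ℝ → ℝ, ∫ w, g w ∂ρ₀ = 1 / 2 * (g 1 + g (-1)) := fun g => by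
    rw [hρdef, integral_smul_measure, integral_symmPair, ENNReal.toReal_ofReal (by norm_num), smul_eq_mul]
  have hρuniv : ρ₀ univ = 1 := by
    rw [hρdef, Measure.smul_apply, symmPair_univ, smul_eq_mul, ← ENNReal.ofReal_ofNat 2,
      ← ENNReal.ofReal_mul (p := 1 / 2) (by norm_num)]
    norm_num
  have hρ0 : ρ₀ {0} = 0 := by
    rw [hρdef, Measure.smul_apply, symmPair_singleton_zero one_ne_zero, smul_zero]
  have hρinv : Integrable (fun w : ℝ => (w ^ 2)⁻¹) ρ₀ :=
    (integrable_symmPair _ 1).smul_measure ENNReal.ofReal_ne_top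
  refine ⟨4, σ, ρ₀, by norm_num, fun k => ⟨by rw [hσuniv]; exact ENNReal.ofReal_lt_top⟩, hσuniv, ?_,
    fun k hk => fourAtom_singleton_zero _ _ (sub_ne_zero.2 (Ne.symm hk)), fun k => fourAtom_map_neg _ _ _,
    fun g hg _ => ?_, ⟨by rw [hρuniv]; exact ENNReal.one_lt_top⟩, by rw [hρuniv]; exact one_pos,
    fun g hg _ => ?_, hρ0, hρinv, fun τ hτ => ?_, not_or.2 ⟨by rw [hρ0]; exact lt_irrefl 0, not_not.2 hρinv⟩⟩
  · -- conservation: `σ 0 = 4 δ₀`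
    show ENNReal.ofReal (1 - Real.cos 0) • (Measure.dirac (1:ℝ) + Measure.dirac (-1)) +
        ENNReal.ofReal (1 + Real.cos 0) • (Measure.dirac (1 - Real.cos 0) + Measure.dirac (-(1 - Real.cos 0)))
      = ENNReal.ofReal 4 • Measure.dirac (0:ℝ)
    rw [Real.cos_zero, sub_self, fourAtom_zero_zero]
    norm_num
  · -- weak continuity of the energy fibres at `k = 0`
    simp_rw [hσint]
    exact (by fun_prop : Continuous fun k : ℝ => (1 - Real.cos k) * (g 1 + g (-1)) +
      (1 + Real.cos k) * (g (1 - Real.cos k) + g (-(1 - Real.cos k)))).tendsto 0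
  · -- the current fibres `ω² σ_k / (2 - 2cos k)` converge weakly to `ρ₀`
    have hF : (fun k : ℝ => 1 / 2 * (g 1 + g (-1)) + (1 + Real.cos k) * (1 - Real.cos k) / 2 *
          (g (1 - Real.cos k) + g (-(1 - Real.cos k))))
        =ᶠ[𝓝[{k : ℝ | Real.cos k ≠ 1}] 0] fun k => ∫ w, g w * (w ^ 2 / (2 - 2 * Real.cos k)) ∂(σ k) := by
      refine eventually_nhdsWithin_of_forall fun k hk => ?_
      have h1 : 1 - Real.cos k ≠ 0 := sub_ne_zero.2 (Ne.symm hk)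
      have h2 : 2 - 2 * Real.cos k = 2 * (1 - Real.cos k) := by ring
      simp only [hσint, h2]
      field_simp
    rw [hρint g]
    refine Tendsto.congr' hF (tendsto_nhdsWithin_of_tendsto_nhds ?_)
    have hc : Continuous fun k : ℝ => 1 / 2 * (g 1 + g (-1)) + (1 + Real.cos k) * (1 - Real.cos k) / 2 *
        (g (1 - Real.cos k) + g (-(1 - Real.cos k))) := by fun_prop
    simpa using hc.tendsto 0
  · -- the heat variance of `ρ₀` (kernel `cos`) is caged by `4`
    have h : ∀ s : ℝ, ∫ w, Real.cos (w * s) ∂ρ₀ = Real.cos (1 * s) := fun s => by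
      simp only [hρint]
      rw [neg_one_mul, Real.cos_neg, one_mul]
      ring
    simp_rw [h]
    rw [Negative.integral_Ioc_sub_mul_cos one_ne_zero hτ, one_mul, one_pow, div_one]
    linarith [Real.neg_one_le_cos τ]

end Summit.AtomisticToContinuum.FouriersLaw.Theorems.UnboundedHeatVariance.Sketch

end
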